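import Literature.Combinatorics.Optimization.PsdMinimalPolytopes
import Mathlib.NumberTheory.Real.Irrational
import HarnessLib

/-!
# Rational and real positive semidefinite rank can be different (Fawzi–Gouveia–Robinson 2016) — PROVED

Source: H. Fawzi, J. Gouveia, R. Z. Robinson, *Rational and real positive semidefinite rank can be
different*, Oper. Res. Lett. 44 (2016) 59–60 = arXiv:1404.4864 [FawziGouveiaRobinson2016] (held text
`paper:arxiv-1404.4864`, two pages; the `8 × 6` matrix of its Figure 1 is quoted from the arXiv
source `examples_rationalPSDrank_ver2.tex`, the figure being absent from the text rendering). Quoted by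
the survey [FawziEtAl2015] in §2.2 "Dependence on the field" (held text `paper:arxiv-1407.4095` p06):
"When the matrix `M` has rational entries, it is natural to define a notion of psd rank where the
factors … are required to have rational entries. If we denote this by `rank_psd^ℚ(M)`, then we clearly
have `rank_psd(M) ≤ rank_psd^ℚ(M)`. In [GFR] it was shown on a `8 × 6` matrix `M` that the inequality
can be strict."

The printed text (p1–p2). **Figure 1**: `M = [[0,0,2,1,0,1],[1,0,0,2,0,1],[0,1,2,0,0,1],[1,2,0,0,0,1],
[0,0,2,1,1,0],[1,0,0,2,1,0],[0,1,2,0,1,0],[1,2,0,0,1,0]]`, "a slack matrix of the polytope with vertices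
`(0,0,0), (1,0,0), (0,1,0), (1,2,0), (0,0,1), (1,0,1), (0,1,1)`, and `(1,2,1)`" (`fgrMatrix`;
`fgrMatrix_eq_slack` checks it against the six facet inequalities of that prism). **Proposition 3**
(quoted tools): "(1) If `√A` is an entry-wise square root of `A`, then `rank_psd A ≤ rank √A`. (2) If `A`
contains a `k × k` triangular submatrix `T`, then `rank_psd A ≥ k`. Furthermore, in a psd factorization
of `A` of size `k`, the factor corresponding to the row (or column) of `T` with `k−1` zeros must have rank
one." **Lemma 4**: "`rank_psd M = 4` and any psd factorization of `M` of size four uses only rank one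
factors." **Proposition 6**: "We have that `rank_psd M = 4`, but there does not exist a psd factorization
of size four using only rational matrices."

Everything is PROVED, with the tree's tools for Proposition 3: (1) = FGPRT Thm 2.9 (v)
(`HasPsdFactorization.hadamardSq`, `PsdRankBasicProperties.lean`), (2) first part = the psd fooling-set
bound (`HasPsdFactorization.card_le_of_triangular`, ibid.), (2) second part = GRT Prop. 2.6 compression
(`rank_rowFactor_add_le` / `rank_colFactor_add_le`, `PsdMinimalPolytopes.lean`) combined with the
fooling-set bound on the columns (rows) where the row (column) vanishes
(`rank_rowFactor_add_le_of_triangular`, `rank_colFactor_add_le_of_triangular`).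

| printed item | Lean | status |
|---|---|---|
| Figure 1, `M` and its slack-matrix provenance | `fgrMatrix`, `fgrMatrix_eq_slack` | DEFINED / PROVED |
| Lemma 4, "entry-wise square root of `M` has usual rank four" ⇒ `rank_psd M ≤ 4` | `fgrMatrix_eq_sq` (explicit `√M = UW` through `ℝ⁴`), `hasPsdFactorization_fgrMatrix_four` | PROVED |
| Lemma 4, triangular submatrix rows `1,5,7,8` × columns `1,2,5,6` ⇒ `rank_psd M ≥ 4` | `four_le_of_hasPsdFactorization_fgrMatrix` | PROVED |
| Lemma 4, all fourteen factors of a size-4 factorization have rank one | `fgrMatrix_factors_rank_le_one` (14 triangular `3`-patterns, by `decide`) | PROVED |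
| "Any rank one psd matrix has the form `vvᵀ`" | `exists_eq_vecMulVec_of_posSemidef_rank_le_one` | PROVED |
| **Proposition 6** | `FawziGouveiaRobinson2016_prop6` | PROVED |
| Remark 5 ("Lemma 4 is a consequence of [GRT13] since our polytope has minimal psd rank") — `M` is GRT 2013 Remark 4.6's prism slack matrix, the tree's `grtPrismSlack` | `fgrMatrix_eq_grtPrismSlack`, `FawziGouveiaRobinson2016_remark5` (appended) | PROVED |

The last step of the printed proof of Proposition 6 (Lemma 2: a rational rank-one psd matrix is
`φ(αq)` with `q` rational; then the `2 × 2` square-root submatrix `[[±1,±1],[±√2,±1]]` on rows `1,2`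
and columns `4,6` cannot be made rational by diagonal scalings) is replaced by an equivalent
choice-free invariant: with `A₁ = xxᵀ, A₂ = x′x′ᵀ, B₄ = yyᵀ, B₆ = y′y′ᵀ`,
`T := Tr(A₁B₄A₂B₆) = ⟨x,y⟩⟨y,x′⟩⟨x′,y′⟩⟨x,y′⟩` (`trace_vecMulVec_four`) is a rational number when the
four factors have rational entries, whereas `T² = M₁₄M₂₄M₂₆M₁₆ = 1·2·1·1 = 2` — impossible since `√2`
is irrational. Rationality of a factor is typed as "every entry is (the cast of) a rational number",
i.e. the printed "using only rational matrices".
-/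

noncomputable section

open Matrix Finset
open scoped MatrixOrder

namespace Literature.Combinatorics.Optimization

/-! ### The matrix -/

/-- The printed `8 × 6` matrix `M` of [FGR16] (Figure 1), with natural-number entries.
[cite: FawziGouveiaRobinson2016, Fig. 1 (p1)] -/
def fgrMatrixN : Fin 8 → Fin 6 → ℕ :=
  ![![0, 0, 2, 1, 0, 1], ![1, 0, 0, 2, 0, 1], ![0, 1, 2, 0, 0, 1], ![1, 2, 0, 0, 0, 1],
    ![0, 0, 2, 1, 1, 0], ![1, 0, 0, 2, 1, 0], ![0, 1, 2, 0, 1, 0], ![1, 2, 0, 0, 1, 0]]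

/-- **The FGR matrix** (Figure 1, verbatim): `M = [[0,0,2,1,0,1],[1,0,0,2,0,1],[0,1,2,0,0,1],
[1,2,0,0,0,1],[0,0,2,1,1,0],[1,0,0,2,1,0],[0,1,2,0,1,0],[1,2,0,0,1,0]]`, "a slack matrix of the polytope
with vertices `(0,0,0), (1,0,0), (0,1,0), (1,2,0), (0,0,1), (1,0,1), (0,1,1), (1,2,1)`" (p1).
[cite: FawziGouveiaRobinson2016, Fig. 1 (p1)] -/
def fgrMatrix : Matrix (Fin 8) (Fin 6) ℝ := fun i j => (fgrMatrixN i j : ℝ)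

/-- The eight printed vertices. [cite: FawziGouveiaRobinson2016, p1] -/
def fgrVertices : Fin 8 → Fin 3 → ℝ :=
  ![![0, 0, 0], ![1, 0, 0], ![0, 1, 0], ![1, 2, 0], ![0, 0, 1], ![1, 0, 1], ![0, 1, 1], ![1, 2, 1]]

/-- Facet inequalities `a_jᵀ x ≤ b_j` of that polytope, in the column order of Figure 1:
`−x ≤ 0`, `−y ≤ 0`, `2x ≤ 2`, `−x + y ≤ 1`, `−z ≤ 0`, `z ≤ 1` (normals).
[cite: FawziGouveiaRobinson2016, Fig. 1 (p1)] -/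
def fgrNormals : Fin 6 → Fin 3 → ℝ :=
  ![![-1, 0, 0], ![0, -1, 0], ![2, 0, 0], ![-1, 1, 0], ![0, 0, -1], ![0, 0, 1]]

/-- Facet inequalities of that polytope: right-hand sides. [cite: FawziGouveiaRobinson2016, Fig. 1 (p1)] -/
def fgrOffsets : Fin 6 → ℝ := ![0, 0, 2, 1, 0, 1]

/-- `M` is the slack matrix `(b_j − a_jᵀ v_i)` of the printed vertices against the six inequalities
`x ≥ 0`, `y ≥ 0`, `2 − 2x ≥ 0`, `1 + x − y ≥ 0`, `z ≥ 0`, `1 − z ≥ 0` (the facets of the prism over the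
quadrilateral `(0,0),(1,0),(0,1),(1,2)`; that these ARE the facets is not used, as in the source:
"we will refrain from using any results about slack matrices in the proofs").
[cite: FawziGouveiaRobinson2016, Fig. 1 (p1)] -/
theorem fgrMatrix_eq_slack (i : Fin 8) (j : Fin 6) :
    fgrMatrix i j = fgrOffsets j - fgrNormals j ⬝ᵥ fgrVertices i := by
  fin_cases i <;> fin_cases j <;>
    simp [fgrMatrix, fgrMatrixN, fgrOffsets, fgrNormals, fgrVertices, dotProduct, Fin.sum_univ_three] <;>
    norm_num

/-- Zero entries of `M` are read off the natural-number table. [cite: FawziGouveiaRobinson2016, Fig. 1 (p1)] -/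
theorem fgrMatrix_eq_zero_iff (i : Fin 8) (j : Fin 6) : fgrMatrix i j = 0 ↔ fgrMatrixN i j = 0 := by
  simp [fgrMatrix]

/-! ### Lemma 4, first half: `rank_psd M = 4` -/

/-- The row coefficients of a rank-`4` factorization `√M = U W` of the entrywise square root of `M`
(rows `5–8` of `√M` are rows `1–4` plus `e₅ − e₆`, and `√2·r₁ − r₂ − √2·r₃ + r₄ = 0`).
[cite: FawziGouveiaRobinson2016, Lemma 4 proof (p2, "the all-nonnegative entry-wise square root of M has usual rank four")] -/
def fgrSqrtU : Fin 8 → Fin 4 → ℝ :=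
  ![![1, 0, 0, 0], ![0, 1, 0, 0], ![0, 0, 1, 0], ![-Real.sqrt 2, 1, Real.sqrt 2, 0],
    ![1, 0, 0, 1], ![0, 1, 0, 1], ![0, 0, 1, 1], ![-Real.sqrt 2, 1, Real.sqrt 2, 1]]

/-- The column coefficients of the rank-`4` factorization of `√M`: rows `1, 2, 3` of `√M` and
`e₅ − e₆`. [cite: FawziGouveiaRobinson2016, Lemma 4 proof (p2)] -/
def fgrSqrtW : Fin 6 → Fin 4 → ℝ :=
  ![![0, 1, 0, 0], ![0, 0, 1, 0], ![Real.sqrt 2, 0, Real.sqrt 2, 0], ![1, Real.sqrt 2, 0, 0],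
    ![0, 0, 0, 1], ![1, 1, 1, -1]]

/-- `M = (UW) ∘ (UW)` entrywise: the all-nonnegative entrywise square root `√M` has the rank-`4`
factorization `U W`. [cite: FawziGouveiaRobinson2016, Lemma 4 proof (p2)] -/
theorem fgrMatrix_eq_sq (i : Fin 8) (j : Fin 6) :
    fgrMatrix i j = (∑ l, fgrSqrtU i l * fgrSqrtW j l) ^ 2 := by
  have h2 : Real.sqrt 2 * Real.sqrt 2 = 2 := Real.mul_self_sqrt (by norm_num)
  fin_cases i <;> fin_cases j <;>
    simp [fgrMatrix, fgrMatrixN, fgrSqrtU, fgrSqrtW, Fin.sum_univ_four, pow_two, h2]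

/-- **Lemma 4, `rank_psd M ≤ 4`** (p2: "the all-nonnegative entry-wise square root of `M` has usual
rank four. Thus Proposition 3 says that `rank_psd M ≤ 4`"), via FGPRT Thm 2.9 (v) / Prop. 3 (1)
(`HasPsdFactorization.hadamardSq`). [cite: FawziGouveiaRobinson2016, Lemma 4 (p2)] -/
theorem hasPsdFactorization_fgrMatrix_four : HasPsdFactorization fgrMatrix 4 := by
  have h := HasPsdFactorization.hadamardSq (M := fun i j => ∑ l, fgrSqrtU i l * fgrSqrtW j l)
    fgrSqrtU fgrSqrtW (fun _ _ => rfl)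
  have hfun : (fun i j => (∑ l, fgrSqrtU i l * fgrSqrtW j l) ^ 2) = fgrMatrix :=
    funext fun i => funext fun j => (fgrMatrix_eq_sq i j).symm
  rwa [hfun] at h

/-- **Lemma 4, `rank_psd M ≥ 4`** (p2: "Consider the submatrix of `M` indexed by rows 1, 5, 7, and 8
and columns 1, 2, 5, and 6. This submatrix is triangular so … `rank_psd M ≥ 4`"), via the psd
fooling-set bound (`HasPsdFactorization.card_le_of_triangular`). [cite: FawziGouveiaRobinson2016, Lemma 4 (p2)] -/
theorem four_le_of_hasPsdFactorization_fgrMatrix {k : ℕ} (h : HasPsdFactorization fgrMatrix k) :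
    4 ≤ k :=
  h.card_le_of_triangular ![0, 4, 6, 7] ![5, 4, 1, 0]
    (fun a ha => by
      have h' : ∀ a : Fin 4, fgrMatrixN (![0, 4, 6, 7] a) (![5, 4, 1, 0] a) ≠ 0 := by decide
      exact h' a ((fgrMatrix_eq_zero_iff _ _).mp ha))
    (fun a b hab => (fgrMatrix_eq_zero_iff _ _).mpr (by
      have h' : ∀ a b : Fin 4, a < b → fgrMatrixN (![0, 4, 6, 7] a) (![5, 4, 1, 0] b) = 0 := by
        decide
      exact h' a b hab))

/-! ### Lemma 4, second half: all factors of a size-4 factorization have rank one -/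

/-- A triangular `n`-pattern inside the columns where row `r` vanishes forces `rank A_r + n ≤ K`
(GRT Prop. 2.6 compression `rank_rowFactor_add_le` + the fooling-set bound): the mechanism of
Proposition 3 (2) (Lee–Theis), "the factor corresponding to the row … with `k−1` zeros must have rank
one". [cite: FawziGouveiaRobinson2016, Prop. 3 (2) (p1–p2)] -/
theorem rank_rowFactor_add_le_of_triangular {ι κ : Type*} {K n : ℕ} {M : ι → κ → ℝ}
    (A : ι → Matrix (Fin K) (Fin K) ℝ) (B : κ → Matrix (Fin K) (Fin K) ℝ)
    (hA : ∀ i, (A i).PosSemidef) (hB : ∀ j, (B j).PosSemidef)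
    (hM : ∀ i j, M i j = (A i * B j).trace) (r : ι) (ρ : Fin n → ι) (γ : Fin n → κ)
    (hγ : ∀ a, M r (γ a) = 0) (hdiag : ∀ a, M (ρ a) (γ a) ≠ 0)
    (hoff : ∀ a b, a < b → M (ρ a) (γ b) = 0) : (A r).rank + n ≤ K :=
  rank_rowFactor_add_le A B hA hB hM r fun _ hk =>
    hk.card_le_of_triangular ρ (fun a => ⟨γ a, hγ a⟩) hdiag hoff

/-- Column version: a triangular `n`-pattern inside the rows where column `c` vanishes forces
`rank B_c + n ≤ K`. [cite: FawziGouveiaRobinson2016, Prop. 3 (2) (p1–p2)] -/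
theorem rank_colFactor_add_le_of_triangular {ι κ : Type*} {K n : ℕ} {M : ι → κ → ℝ}
    (A : ι → Matrix (Fin K) (Fin K) ℝ) (B : κ → Matrix (Fin K) (Fin K) ℝ)
    (hA : ∀ i, (A i).PosSemidef) (hB : ∀ j, (B j).PosSemidef)
    (hM : ∀ i j, M i j = (A i * B j).trace) (c : κ) (ρ : Fin n → ι) (γ : Fin n → κ)
    (hρ : ∀ a, M (ρ a) c = 0) (hdiag : ∀ a, M (ρ a) (γ a) ≠ 0)
    (hoff : ∀ a b, a < b → M (ρ a) (γ b) = 0) : (B c).rank + n ≤ K :=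
  rank_colFactor_add_le A B hA hB hM c fun _ hk =>
    hk.card_le_of_triangular (fun a => ⟨ρ a, hρ a⟩) γ hdiag hoff

/-- **Lemma 4, second half** (p2, verbatim): "any psd factorization of `M` of size four uses only rank
one factors … It is easy to verify by inspection that for every row and column of `M` we can find a
`4 × 4` triangular submatrix such that the row or column in question has three zeros in that
submatrix." The fourteen triangular `3`-patterns are listed in the proof.
[cite: FawziGouveiaRobinson2016, Lemma 4 (p2)] -/
theorem fgrMatrix_factors_rank_le_one (A : Fin 8 → Matrix (Fin 4) (Fin 4) ℝ)
    (B : Fin 6 → Matrix (Fin 4) (Fin 4) ℝ) (hA : ∀ i, (A i).PosSemidef) (hB : ∀ j, (B j).PosSemidef)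
    (hM : ∀ i j, fgrMatrix i j = (A i * B j).trace) :
    (∀ i, (A i).rank ≤ 1) ∧ ∀ j, (B j).rank ≤ 1 := by
  have row : ∀ (r : Fin 8) (ρ : Fin 3 → Fin 8) (γ : Fin 3 → Fin 6),
      (∀ a, fgrMatrixN r (γ a) = 0) → (∀ a, fgrMatrixN (ρ a) (γ a) ≠ 0) →
      (∀ a b, a < b → fgrMatrixN (ρ a) (γ b) = 0) → (A r).rank ≤ 1 := by
    intro r ρ γ h1 h2 h3
    have h := rank_rowFactor_add_le_of_triangular A B hA hB hM r ρ γ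
      (fun a => (fgrMatrix_eq_zero_iff _ _).mpr (h1 a))
      (fun a ha => h2 a ((fgrMatrix_eq_zero_iff _ _).mp ha))
      (fun a b hab => (fgrMatrix_eq_zero_iff _ _).mpr (h3 a b hab))
    omega
  have col : ∀ (c : Fin 6) (ρ : Fin 3 → Fin 8) (γ : Fin 3 → Fin 6),
      (∀ a, fgrMatrixN (ρ a) c = 0) → (∀ a, fgrMatrixN (ρ a) (γ a) ≠ 0) →
      (∀ a b, a < b → fgrMatrixN (ρ a) (γ b) = 0) → (B c).rank ≤ 1 := by
    intro c ρ γ h1 h2 h3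
    have h := rank_colFactor_add_le_of_triangular A B hA hB hM c ρ γ
      (fun a => (fgrMatrix_eq_zero_iff _ _).mpr (h1 a))
      (fun a ha => h2 a ((fgrMatrix_eq_zero_iff _ _).mp ha))
      (fun a b hab => (fgrMatrix_eq_zero_iff _ _).mpr (h3 a b hab))
    omega
  refine ⟨fun i => ?_, fun j => ?_⟩
  · fin_cases i
    · exact row 0 ![4, 2, 1] ![4, 1, 0] (by decide) (by decide) (by decide)
    · exact row 1 ![5, 3, 0] ![4, 1, 2] (by decide) (by decide) (by decide)
    · exact row 2 ![6, 0, 1] ![4, 3, 0] (by decide) (by decide) (by decide)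
    · exact row 3 ![7, 1, 0] ![4, 3, 2] (by decide) (by decide) (by decide)
    · exact row 4 ![0, 2, 1] ![5, 1, 0] (by decide) (by decide) (by decide)
    · exact row 5 ![1, 3, 0] ![5, 1, 2] (by decide) (by decide) (by decide)
    · exact row 6 ![2, 0, 1] ![5, 3, 0] (by decide) (by decide) (by decide)
    · exact row 7 ![3, 1, 0] ![5, 3, 2] (by decide) (by decide) (by decide)
  · fin_cases j
    · exact col 0 ![4, 0, 2] ![4, 5, 1] (by decide) (by decide) (by decide)
    · exact col 1 ![4, 0, 1] ![4, 5, 0] (by decide) (by decide) (by decide)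
    · exact col 2 ![5, 1, 3] ![4, 5, 1] (by decide) (by decide) (by decide)
    · exact col 3 ![6, 2, 3] ![4, 5, 0] (by decide) (by decide) (by decide)
    · exact col 4 ![0, 2, 1] ![2, 1, 0] (by decide) (by decide) (by decide)
    · exact col 5 ![4, 6, 5] ![2, 1, 0] (by decide) (by decide) (by decide)

/-! ### Rank-one psd matrices and a trace identity -/

/-- A real psd matrix of rank `≤ 1` is `v vᵀ` ("Any rank one psd matrix has the form `v vᵀ`", p1).
[cite: FawziGouveiaRobinson2016, p1 (before Lemma 2)] -/
theorem exists_eq_vecMulVec_of_posSemidef_rank_le_one {k : ℕ} {A : Matrix (Fin k) (Fin k) ℝ}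
    (hA : A.PosSemidef) (hr : A.rank ≤ 1) : ∃ v : Fin k → ℝ, A = vecMulVec v v := by
  classical
  obtain ⟨a, b, hab⟩ := exists_biFactorization_of_rank_le A hr
  have hab' : ∀ s t, A s t = a s 0 * b t 0 := fun s t => by
    rw [hab s t, Fin.sum_univ_one]
  have hsymm : ∀ s t, A t s = A s t := fun s t => by simpa using hA.1.apply s t
  have hdiag : ∀ s, 0 ≤ A s s := fun s => hA.diag_nonneg
  by_cases hzero : ∀ s t, A s t = 0
  · refine ⟨0, ?_⟩
    ext s t
    simp [vecMulVec_apply, hzero s t]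
  · simp only [not_forall] at hzero
    obtain ⟨s₀, t₀, hst⟩ := hzero
    have h1 : a s₀ 0 * b t₀ 0 ≠ 0 := by rwa [← hab']
    have h2 : a t₀ 0 * b s₀ 0 ≠ 0 := by rwa [← hab', hsymm]
    have hc : A s₀ s₀ ≠ 0 := by
      rw [hab']
      exact mul_ne_zero (left_ne_zero_of_mul h1) (right_ne_zero_of_mul h2)
    have hcpos : 0 < A s₀ s₀ := lt_of_le_of_ne (hdiag s₀) (Ne.symm hc)
    set c := A s₀ s₀ with hcdef
    refine ⟨fun s => A s s₀ / Real.sqrt c, ?_⟩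
    ext s t
    rw [vecMulVec_apply, div_mul_div_comm, Real.mul_self_sqrt hcpos.le]
    have key : A s s₀ * A t s₀ = A s t * c := by
      rw [hsymm s₀ t, hcdef, hab' s s₀, hab' s₀ t, hab' s t, hab' s₀ s₀]
      ring
    rw [key, mul_div_assoc, div_self (ne_of_gt hcpos), mul_one]

/-- `Tr(x xᵀ y yᵀ) = ⟨x, y⟩²` ("by the properties of the trace, `M_{ij} = ⟨A_i,B_j⟩ = ⟨a_i,b_j⟩²`", p2;
a private copy of the tree's `SosDegreeVersusPsdRank` lemma of the same name, to keep imports light).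
[cite: FawziGouveiaRobinson2016, Prop. 6 proof (p2)] -/
private theorem trace_outerSelf_mul_outerSelf {k : ℕ} (x y : Fin k → ℝ) :
    (vecMulVec x x * vecMulVec y y).trace = (x ⬝ᵥ y) ^ 2 := by
  rw [vecMulVec_mul_vecMulVec, trace_vecMulVec, dotProduct_smul, smul_eq_mul, sq]

/-- The four-fold trace `Tr(x xᵀ · y yᵀ · x′x′ᵀ · y′y′ᵀ) = ⟨x,y⟩⟨y,x′⟩⟨x′,y′⟩⟨x,y′⟩` — the product
of four entries of the entrywise square root `S = (⟨a_i, b_j⟩)` used in the proof of Proposition 6.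
[cite: FawziGouveiaRobinson2016, Prop. 6 proof (p2)] -/
theorem trace_vecMulVec_four {k : ℕ} (x y x' y' : Fin k → ℝ) :
    (vecMulVec x x * vecMulVec y y * vecMulVec x' x' * vecMulVec y' y').trace =
      (x ⬝ᵥ y) * (y ⬝ᵥ x') * (x' ⬝ᵥ y') * (x ⬝ᵥ y') := by
  rw [vecMulVec_mul_vecMulVec, vecMulVec_mul_vecMulVec, vecMulVec_mul_vecMulVec, trace_vecMulVec]
  simp only [smul_dotProduct, dotProduct_smul, smul_eq_mul]

/-! ### Proposition 6: no rational psd factorization of size four -/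

/-- A real matrix with rational entries is the cast of a rational matrix. [folklore] -/
private theorem exists_map_ratCast_of_entries {m n : Type*} (A : Matrix m n ℝ)
    (h : ∀ s t, ∃ q : ℚ, (q : ℝ) = A s t) :
    ∃ Aq : Matrix m n ℚ, Aq.map (Rat.castHom ℝ) = A := by
  choose q hq using h
  exact ⟨Matrix.of fun s t => q s t, by ext s t; simp [hq]⟩

/-- **Proposition 6 of [FGR16]** (p2, verbatim): "We have that `rank_psd M = 4`, but there does not
exist a psd factorization of size four using only rational matrices." — together with **Lemma 4**
("`rank_psd M = 4` and any psd factorization of `M` of size four uses only rank one factors"): this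
answers negatively the question (FGPRT §2.2) whether the psd rank of a rational matrix is always
attained by rational psd factors. Typed: `M` has a real psd factorization of size `4`, none of size
`≤ 3`, and NO size-`4` psd factorization all of whose fourteen factors have rational entries.
Proof as printed up to its last step, which is made choice-free: all factors are rank one,
`A_i = a_i a_iᵀ`, `B_j = b_j b_jᵀ`, so `T := Tr(A₁B₄A₂B₆) = ⟨a₁,b₄⟩⟨b₄,a₂⟩⟨a₂,b₆⟩⟨a₁,b₆⟩` is rational
when the factors are, while `T² = M₁₄ M₂₄ M₂₆ M₁₆ = 1·2·1·1 = 2` (the printed `2 × 2` square-root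
submatrix `[[±1, ±1],[±√2, ±1]]` on rows `1, 2` and columns `4, 6`), contradicting the irrationality
of `√2`. [cite: FawziGouveiaRobinson2016, Prop. 6 and Lemma 4 (p2)] -/
theorem FawziGouveiaRobinson2016_prop6 :
    HasPsdFactorization fgrMatrix 4 ∧ ¬ HasPsdFactorization fgrMatrix 3 ∧
      ¬ ∃ (A : Fin 8 → Matrix (Fin 4) (Fin 4) ℝ) (B : Fin 6 → Matrix (Fin 4) (Fin 4) ℝ),
        (∀ i, (A i).PosSemidef) ∧ (∀ j, (B j).PosSemidef) ∧
        (∀ i j, fgrMatrix i j = (A i * B j).trace) ∧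
        (∀ i s t, ∃ q : ℚ, (q : ℝ) = A i s t) ∧ (∀ j s t, ∃ q : ℚ, (q : ℝ) = B j s t) := by
  refine ⟨hasPsdFactorization_fgrMatrix_four,
    fun h => by have := four_le_of_hasPsdFactorization_fgrMatrix h; omega, ?_⟩
  rintro ⟨A, B, hA, hB, hM, hAq, hBq⟩
  -- rank-one factors `A_1 = x xᵀ`, `A_2 = x' x'ᵀ`, `B_4 = y yᵀ`, `B_6 = y' y'ᵀ`
  obtain ⟨hArk, hBrk⟩ := fgrMatrix_factors_rank_le_one A B hA hB hM
  obtain ⟨x, hx⟩ := exists_eq_vecMulVec_of_posSemidef_rank_le_one (hA 0) (hArk 0)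
  obtain ⟨x', hx'⟩ := exists_eq_vecMulVec_of_posSemidef_rank_le_one (hA 1) (hArk 1)
  obtain ⟨y, hy⟩ := exists_eq_vecMulVec_of_posSemidef_rank_le_one (hB 3) (hBrk 3)
  obtain ⟨y', hy'⟩ := exists_eq_vecMulVec_of_posSemidef_rank_le_one (hB 5) (hBrk 5)
  -- the four entries of `M`
  have h14 : (x ⬝ᵥ y) ^ 2 = 1 := by
    rw [← trace_outerSelf_mul_outerSelf, ← hx, ← hy, ← hM]; simp [fgrMatrix, fgrMatrixN]
  have h24 : (x' ⬝ᵥ y) ^ 2 = 2 := by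
    rw [← trace_outerSelf_mul_outerSelf, ← hx', ← hy, ← hM]; simp [fgrMatrix, fgrMatrixN]
  have h26 : (x' ⬝ᵥ y') ^ 2 = 1 := by
    rw [← trace_outerSelf_mul_outerSelf, ← hx', ← hy', ← hM]; simp [fgrMatrix, fgrMatrixN]
  have h16 : (x ⬝ᵥ y') ^ 2 = 1 := by
    rw [← trace_outerSelf_mul_outerSelf, ← hx, ← hy', ← hM]; simp [fgrMatrix, fgrMatrixN]
  -- `T = Tr(A₁ B₄ A₂ B₆)` satisfies `T² = 2`
  set T : ℝ := (A 0 * B 3 * A 1 * B 5).trace with hT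
  have hT2 : T ^ 2 = 2 := by
    rw [hT, hx, hy, hx', hy', trace_vecMulVec_four, dotProduct_comm y x']
    calc ((x ⬝ᵥ y) * (x' ⬝ᵥ y) * (x' ⬝ᵥ y') * (x ⬝ᵥ y')) ^ 2
        = (x ⬝ᵥ y) ^ 2 * (x' ⬝ᵥ y) ^ 2 * (x' ⬝ᵥ y') ^ 2 * (x ⬝ᵥ y') ^ 2 := by ring
      _ = 2 := by rw [h14, h24, h26, h16]; norm_num
  -- `T` is rational
  obtain ⟨A0, hA0⟩ := exists_map_ratCast_of_entries (A 0) (hAq 0)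
  obtain ⟨A1, hA1⟩ := exists_map_ratCast_of_entries (A 1) (hAq 1)
  obtain ⟨B3, hB3⟩ := exists_map_ratCast_of_entries (B 3) (hBq 3)
  obtain ⟨B5, hB5⟩ := exists_map_ratCast_of_entries (B 5) (hBq 5)
  set t : ℚ := (A0 * B3 * A1 * B5).trace with ht
  have hTt : T = (t : ℝ) := by
    rw [hT, ← hA0, ← hA1, ← hB3, ← hB5, ← Matrix.map_mul, ← Matrix.map_mul, ← Matrix.map_mul,
      ← AddMonoidHom.map_trace (Rat.castHom ℝ)]
    rfl
  -- contradiction with the irrationality of `√2`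
  have hsqrt : Real.sqrt 2 = |(t : ℝ)| := by
    rw [← hTt, ← Real.sqrt_sq_eq_abs, hT2]
  exact irrational_sqrt_two.ne_rat |t| (by rw [hsqrt, Rat.cast_abs])

/-! ### Remark 5: the link with GRT 2013 (appended) -/

/-- FGR's Figure 1 matrix IS the printed slack matrix of GRT 2013 Remark 4.6's prism — the same eight
vertices `(0,0,0), (1,0,0), (0,1,0), (1,2,0), (0,0,1), (1,0,1), (0,1,1), (1,2,1)`, facets in the same
order — i.e. the tree's `grtPrismSlack` (`PsdMinimalPolytopes.lean`, where Remark 4.6 "minimal psd rank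
but not `0/1`-scalable" is proved). [cite: FawziGouveiaRobinson2016, Fig. 1 and Remark 5 (p1–p2);
GouveiaRobinsonThomas2013, Remark 4.6 (p11)] -/
theorem fgrMatrix_eq_grtPrismSlack : fgrMatrix = grtPrismSlack := by
  ext i j
  fin_cases i <;> fin_cases j <;> norm_num [fgrMatrix, fgrMatrixN, grtPrismSlack]

/-- **FGR Remark 5** (p2, verbatim): "Note that Lemma 4 is actually a consequence of [GRT13] since our
polytope has minimal psd rank (equal to the ambient dimension plus one) and thus any psd
factorization must consist entirely of rank-one factors." In the tree: GRT Remark 4.6's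
`grtPrismSlack_psdRank` (`rank_psd = 4 = 3 + 1`) is Lemma 4's first half for the same matrix, and
Lemma 4's second half is `fgrMatrix_factors_rank_le_one`; conversely `GouveiaRobinsonThomas2013_remark46`
transfers to `fgrMatrix`. [cite: FawziGouveiaRobinson2016, Remark 5 (p2); GouveiaRobinsonThomas2013,
Remark 4.6 (p11)] -/
theorem FawziGouveiaRobinson2016_remark5 :
    (HasPsdFactorization fgrMatrix 4 ∧ ∀ k, HasPsdFactorization fgrMatrix k → 4 ≤ k) ∧
    (∀ (A : Fin 8 → Matrix (Fin 4) (Fin 4) ℝ) (B : Fin 6 → Matrix (Fin 4) (Fin 4) ℝ),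
      (∀ i, (A i).PosSemidef) → (∀ j, (B j).PosSemidef) →
      (∀ i j, fgrMatrix i j = (A i * B j).trace) → (∀ i, (A i).rank ≤ 1) ∧ ∀ j, (B j).rank ≤ 1) ∧
    ¬ ∃ (r : Fin 8 → ℝ) (c : Fin 6 → ℝ), (∀ i, 0 < r i) ∧ (∀ j, 0 < c j) ∧
      ∀ i j, r i * fgrMatrix i j * c j = 0 ∨ r i * fgrMatrix i j * c j = 1 := by
  refine ⟨?_, fun A B hA hB hM => fgrMatrix_factors_rank_le_one A B hA hB hM, ?_⟩
  · rw [fgrMatrix_eq_grtPrismSlack]; exact grtPrismSlack_psdRank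
  · rw [fgrMatrix_eq_grtPrismSlack]; exact grtPrismSlack_not_scalable

end Literature.Combinatorics.Optimization
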